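import Summits.QuantumFields.YangMills.Theorems.ColdStartUniversalityLatticeLangevinWilsonGeneratorPoincare
import Summits.QuantumFields.YangMills.Theorems.ColdStartUniversalityLatticeLangevinWilsonGeneratorPoincareOfDecay
import HarnessLib

/-!
# Route `ColdStartUniversality` (fixed-cut-off `L²(μ_{β'})` package): HOLLEY–STROOCK TRANSFER of the generator-form Poincaré
# inequality from `β' = 0` (product Haar) to the Wilson measure `μ_{β'}`, with the explicit factor `e^{−|β'|·4·#plaquettes}`

Helper file (seat `ym-line-csu-p1`, g19; `--supports stmt-QuantumFields-27363`).  For the SU(2) lattice Langevin dynamics of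
Shen–Zhu–Zhu on `(ℤ/L)³` the Wilson measure is `μ_{β'} = Z⁻¹ e^{−β'S} Haar^{⊗E}` with `0 ≤ S ≤ 4·#𝒫` (`S = Σ_p (2 − Re tr U_p)`), and the
carré du champ `Γ(f,f) = Σ_{ij} ∂_i f ∂_j f (σσᵀ)_{ij}` of the SZZ coordinate generator does NOT depend on `β'` (only the drift does).
Hence the classical bounded-perturbation lemma of Holley–Stroock applies VERBATIM to the generator-form Poincaré inequality of the tree
(`−∫ (F − μF) 𝓛f dμ = ½ ∫ Γ(f,f) dμ`, `two_mul_integral_mul_generator_eq_neg_carre` + `integral_generator_wilson_eq_zero`, both at `β'`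
and at `0`):

* `abs_re_trace_fundamentalRep_le_two`, `wilsonAction_su2_nonneg`, `wilsonAction_su2_le` — `0 ≤ S ≤ 4·#𝒫` on `SU(2)^E`;
* `continuous_wilsonAction_su2` — continuity of the Wilson action;
* `carreDuChamp_nonneg` — `Γ(f,f) ≥ 0` pointwise (a sum of squares);
* ★★ `generatorPoincare_holleyStroock` — if product Haar measure (`μ₀ = wilsonMeasure 0`) satisfies the generator-form Poincaré
  inequality with constant `λ₀ ≥ 0` on all `C³` cylinder functions, then `μ_{β'}` satisfies it with constant `λ₀ e^{−|β'|·4·#𝒫}`: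
  `λ₀ e^{−4|β'|#𝒫} Var_{μ_{β'}}(F) ≤ −∫ (F − μ_{β'}F) 𝓛_{β'}f dμ_{β'}`.  Proof: localise `F − m = g∘coords` with `g` compactly supported;
  `Var_{β'}(G) ≤ ∫ (G − μ₀G)² dμ_{β'} ≤ (sup w/Z) Var₀(G) ≤ (sup w/Z) λ₀⁻¹ ½∫Γ dμ₀ ≤ (sup w/inf w) λ₀⁻¹ ½∫Γ dμ_{β'}`, `w = e^{−β'S}`,
  `sup w / inf w ≤ e^{|β'|·osc S} ≤ e^{4|β'|#𝒫}`.

With `haar_generatorPoincare` (`λ₀ = 3/2`, `…HaarSpectralGap`) and g18's `integral_sq_transition_sub_le_exp_of_generatorPoincare` this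
gives the first EXPLICIT `L²(μ_{β'})` spectral gap of the SZZ dynamics at every fixed cut-off (`…WilsonExplicitGap`).
THEOREMS ONLY, no definition, no sorry.  HONEST FRAMING: RECORD-rung R3 plumbing at FIXED cut-off; the constant degenerates like
`e^{−12|β'|L³}` and carries NO cut-off-uniform information (the K-uniform Poincaré inequality in physical units is the open crux in `L²`
form); no crux, rung or summit statement is proved; the Yang–Mills mass gap is NOT proved.
-/

set_option autoImplicit false

noncomputable section

namespace Summit.QuantumFields.YangMills.Theorems.ColdStartUniversality

open MeasureTheory ProbabilityTheory Finset Filter Set Topology Metric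
open scoped BigOperators NNReal ENNReal
open Literature.Probability.Process Literature.MathematicalPhysics.QuantumFieldTheory
open Literature.MathematicalPhysics.QuantumLattice (fundamentalRep fundamentalLatticeRep continuous_fundamentalRep)

variable {L : ℕ} [NeZero L]

/-! ## The Wilson action of `SU(2)` lattice gauge theory: `0 ≤ S ≤ 4·#𝒫`, continuity -/

/-- `|Re tr g| ≤ 2` for `g ∈ SU(2)` (entries of a unitary matrix have modulus `≤ 1`). [folklore] -/
theorem abs_re_trace_fundamentalRep_le_two (g : Matrix.specialUnitaryGroup (Fin 2) ℂ) :
    |((fundamentalRep (Fin 2) g : Matrix (Fin 2) (Fin 2) ℂ)).trace.re| ≤ 2 := by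
  have hU : (fundamentalRep (Fin 2) g : Matrix (Fin 2) (Fin 2) ℂ) ∈ Matrix.unitaryGroup (Fin 2) ℂ :=
    Matrix.specialUnitaryGroup_le_unitaryGroup g.2
  rw [Matrix.trace_fin_two, Complex.add_re]
  have h0 := (Complex.abs_re_le_norm _).trans (entry_norm_bound_of_unitary hU 0 0)
  have h1 := (Complex.abs_re_le_norm _).trans (entry_norm_bound_of_unitary hU 1 1)
  rw [abs_le] at h0 h1 ⊢
  constructor <;> linarith [h0.1, h0.2, h1.1, h1.2]

/-- `0 ≤ S(U)` for the `SU(2)` Wilson action `S(U) = Σ_p (2 − Re tr U_p)`. [folklore] -/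
theorem wilsonAction_su2_nonneg (U : GaugeConfig 3 L (Matrix.specialUnitaryGroup (Fin 2) ℂ)) :
    0 ≤ wilsonAction (fundamentalRep (Fin 2)) U := by
  unfold wilsonAction
  refine Finset.sum_nonneg fun p _ => ?_
  have h := abs_re_trace_fundamentalRep_le_two (plaquetteHolonomy U p.1 p.2.1.1 p.2.1.2)
  rw [abs_le] at h
  push_cast
  linarith [h.2]

/-- `S(U) ≤ 4·#𝒫` for the `SU(2)` Wilson action on the torus `(ℤ/L)³`. [folklore] -/
theorem wilsonAction_su2_le (U : GaugeConfig 3 L (Matrix.specialUnitaryGroup (Fin 2) ℂ)) :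
    wilsonAction (fundamentalRep (Fin 2)) U ≤ 4 * (Fintype.card (Plaquette 3 L) : ℝ) := by
  unfold wilsonAction
  have h : ∀ p ∈ (Finset.univ : Finset (Plaquette 3 L)),
      ((2 : ℕ) : ℝ) - ((fundamentalRep (Fin 2) (plaquetteHolonomy U p.1 p.2.1.1 p.2.1.2) :
        Matrix (Fin 2) (Fin 2) ℂ)).trace.re ≤ 4 := by
    intro p _
    have h := abs_re_trace_fundamentalRep_le_two (plaquetteHolonomy U p.1 p.2.1.1 p.2.1.2)
    rw [abs_le] at h
    push_cast
    linarith [h.1]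
  calc _ ≤ ∑ _p : Plaquette 3 L, (4 : ℝ) := Finset.sum_le_sum h
    _ = 4 * (Fintype.card (Plaquette 3 L) : ℝ) := by
        rw [Finset.sum_const, Finset.card_univ, nsmul_eq_mul, mul_comm]

/-- The `SU(2)` Wilson action is continuous on `SU(2)^E`. [folklore] -/
theorem continuous_wilsonAction_su2 :
    Continuous fun U : GaugeConfig 3 L (Matrix.specialUnitaryGroup (Fin 2) ℂ) => wilsonAction (fundamentalRep (Fin 2)) U := by
  unfold wilsonAction
  refine continuous_finsetSum _ fun p _ => continuous_const.sub ?_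
  have hhol : Continuous fun U : GaugeConfig 3 L (Matrix.specialUnitaryGroup (Fin 2) ℂ) =>
      plaquetteHolonomy U p.1 p.2.1.1 p.2.1.2 := by
    unfold plaquetteHolonomy; fun_prop
  exact Complex.continuous_re.comp (((continuous_fundamentalRep (Fin 2)).comp hhol).matrix_trace)

/-! ## The carré du champ is a sum of squares -/

/-- **`Γ(f,f) ≥ 0` pointwise**: `Σ_{ij} a_i a_j Σ_n σ_{in} σ_{jn} = Σ_n (Σ_i a_i σ_{in})² ≥ 0`. [folklore] -/
theorem carreDuChamp_nonneg {I N : Type*} [Fintype I] [Fintype N] (a : I → ℝ) (σ : I → N → ℝ) :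
    0 ≤ ∑ i, ∑ j, a i * a j * ∑ n, σ i n * σ j n := by
  have hre : ∑ i, ∑ j, a i * a j * ∑ n, σ i n * σ j n = ∑ n, (∑ i, a i * σ i n) ^ 2 := by
    have h1 : ∀ n, (∑ i, a i * σ i n) ^ 2 = ∑ i, ∑ j, a i * σ i n * (a j * σ j n) := fun n => by
      rw [sq, Finset.sum_mul_sum]
    simp_rw [h1, Finset.mul_sum]
    conv_rhs => rw [Finset.sum_comm]
    refine Finset.sum_congr rfl fun i _ => ?_
    conv_rhs => rw [Finset.sum_comm]
    refine Finset.sum_congr rfl fun j _ => ?_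
    exact Finset.sum_congr rfl fun n _ => by ring
  rw [hre]
  exact Finset.sum_nonneg fun n _ => sq_nonneg _

/-! ## ★★ Holley–Stroock for the generator-form Poincaré inequality -/

/-- ★★ **Holley–Stroock transfer, generator form.**  If product Haar measure `μ₀ = wilsonMeasure 0` on `SU(2)^E` satisfies the
generator-form Poincaré inequality `λ₀ Var_{μ₀}(F) ≤ −∫ (F − μ₀F) 𝓛₀f dμ₀` for every `C³` cylinder `F = f∘coords` (`𝓛₀` the SZZ
coordinate generator at `β' = 0`), then for every `β'` the Wilson measure `μ_{β'}` satisfies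
`λ₀ e^{−|β'|·4·#𝒫} Var_{μ_{β'}}(F) ≤ −∫ (F − μ_{β'}F) 𝓛_{β'}f dμ_{β'}` for every `C³` `f`.  Ingredients: localisation
`F − m = g∘coords` (`g = χ·(f − m)` compactly supported, `𝓛g = 𝓛f` on the group); the energy identity
`−2∫ G 𝓛g dμ = ∫ Γ(g,g) dμ` at `β'` and at `0` with the SAME `Γ` (the noise coefficients do not depend on `β'`);
`∫ 𝓛₀g dμ₀ = 0`; `Var ≤ ∫ (G − c)²`; `μ_{β'} = (∫ · e^{−β'S} dμ₀)/(∫ e^{−β'S} dμ₀)` (`wilsonExpectation_eq_integral_div`) and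
`sup e^{−β'S} ≤ e^{4|β'|#𝒫} inf e^{−β'S}` (`0 ≤ S ≤ 4#𝒫`).
[cite: HolleyStroock1987] [cite: BakryGentilLedoux2014, Prop. 4.2.7] -/
theorem generatorPoincare_holleyStroock (L : ℕ) [NeZero L] (β' : ℝ) {lam0 : ℝ} (hlam0 : 0 ≤ lam0)
    (hP0 : ∀ (f : (Edge 3 L × Fin 2 × Fin 2 × Bool → ℝ) → ℝ), ContDiff ℝ 3 f →
        let coords : GaugeConfig 3 L (Matrix.specialUnitaryGroup (Fin 2) ℂ) → (Edge 3 L × Fin 2 × Fin 2 × Bool → ℝ) :=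
          fun V q => (fun z : ℂ => if q.2.2.2 then z.im else z.re)
            ((fundamentalRep (Fin 2) (V q.1) : Matrix (Fin 2) (Fin 2) ℂ) q.2.1 q.2.2.1)
        let gen : GaugeConfig 3 L (Matrix.specialUnitaryGroup (Fin 2) ℂ) → ℝ := fun V =>
          (∑ i : Edge 3 L × Fin 2 × Fin 2 × Bool, fderiv ℝ f (coords V) (Pi.single i 1) *
              (fun z : ℂ => if i.2.2.2 then z.im else z.re)
                ((latticeLangevinDynamics (fundamentalLatticeRep 2) 0).drift
                  (matrixConfig (fundamentalRep (Fin 2)) V) i.1 i.2.1 i.2.2.1) +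
          1 / 2 * ∑ i : Edge 3 L × Fin 2 × Fin 2 × Bool, ∑ j : Edge 3 L × Fin 2 × Fin 2 × Bool,
            fderiv ℝ (fun z => fderiv ℝ f z (Pi.single i 1)) (coords V) (Pi.single j 1) *
              ∑ n : Edge 3 L × NoiseIdx 2,
                (if n.1 = i.1 then (fun z : ℂ => if i.2.2.2 then z.im else z.re)
                  ((latticeLangevinDynamics (fundamentalLatticeRep 2) 0).noise
                    (matrixConfig (fundamentalRep (Fin 2)) V) i.1 n.2 i.2.1 i.2.2.1) else 0) *
                (if n.1 = j.1 then (fun z : ℂ => if j.2.2.2 then z.im else z.re)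
                  ((latticeLangevinDynamics (fundamentalLatticeRep 2) 0).noise
                    (matrixConfig (fundamentalRep (Fin 2)) V) j.1 n.2 j.2.1 j.2.2.1) else 0))
        lam0 * ∫ V, (f (coords V) - ∫ V', f (coords V') ∂(wilsonMeasure (d := 3) (L := L) (fundamentalRep (Fin 2)) 0)) ^ 2
            ∂(wilsonMeasure (d := 3) (L := L) (fundamentalRep (Fin 2)) 0) ≤
          -∫ V, (f (coords V) - ∫ V', f (coords V') ∂(wilsonMeasure (d := 3) (L := L) (fundamentalRep (Fin 2)) 0)) *
            gen V ∂(wilsonMeasure (d := 3) (L := L) (fundamentalRep (Fin 2)) 0))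
    (f : (Edge 3 L × Fin 2 × Fin 2 × Bool → ℝ) → ℝ) (hf : ContDiff ℝ 3 f) :
    let coords : GaugeConfig 3 L (Matrix.specialUnitaryGroup (Fin 2) ℂ) → (Edge 3 L × Fin 2 × Fin 2 × Bool → ℝ) :=
      fun V q => (fun z : ℂ => if q.2.2.2 then z.im else z.re)
        ((fundamentalRep (Fin 2) (V q.1) : Matrix (Fin 2) (Fin 2) ℂ) q.2.1 q.2.2.1)
    let gen : GaugeConfig 3 L (Matrix.specialUnitaryGroup (Fin 2) ℂ) → ℝ := fun V =>
      (∑ i : Edge 3 L × Fin 2 × Fin 2 × Bool, fderiv ℝ f (coords V) (Pi.single i 1) *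
          (fun z : ℂ => if i.2.2.2 then z.im else z.re)
            ((latticeLangevinDynamics (fundamentalLatticeRep 2) β').drift
              (matrixConfig (fundamentalRep (Fin 2)) V) i.1 i.2.1 i.2.2.1) +
      1 / 2 * ∑ i : Edge 3 L × Fin 2 × Fin 2 × Bool, ∑ j : Edge 3 L × Fin 2 × Fin 2 × Bool,
        fderiv ℝ (fun z => fderiv ℝ f z (Pi.single i 1)) (coords V) (Pi.single j 1) *
          ∑ n : Edge 3 L × NoiseIdx 2,
            (if n.1 = i.1 then (fun z : ℂ => if i.2.2.2 then z.im else z.re)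
              ((latticeLangevinDynamics (fundamentalLatticeRep 2) β').noise
                (matrixConfig (fundamentalRep (Fin 2)) V) i.1 n.2 i.2.1 i.2.2.1) else 0) *
            (if n.1 = j.1 then (fun z : ℂ => if j.2.2.2 then z.im else z.re)
              ((latticeLangevinDynamics (fundamentalLatticeRep 2) β').noise
                (matrixConfig (fundamentalRep (Fin 2)) V) j.1 n.2 j.2.1 j.2.2.1) else 0))
    lam0 * Real.exp (-(|β'| * (4 * (Fintype.card (Plaquette 3 L) : ℝ)))) *
        ∫ V, (f (coords V) - ∫ V', f (coords V') ∂(wilsonMeasure (d := 3) (L := L) (fundamentalRep (Fin 2)) β')) ^ 2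
          ∂(wilsonMeasure (d := 3) (L := L) (fundamentalRep (Fin 2)) β') ≤
      -∫ V, (f (coords V) - ∫ V', f (coords V') ∂(wilsonMeasure (d := 3) (L := L) (fundamentalRep (Fin 2)) β')) *
        gen V ∂(wilsonMeasure (d := 3) (L := L) (fundamentalRep (Fin 2)) β') := by
  intro coords gen
  classical
  haveI := secondCountableTopology_su2
  haveI := borelSpace_config L
  set μ : Measure (GaugeConfig 3 L (Matrix.specialUnitaryGroup (Fin 2) ℂ)) :=
    wilsonMeasure (d := 3) (L := L) (fundamentalRep (Fin 2)) β' with hμ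
  set μ₀ : Measure (GaugeConfig 3 L (Matrix.specialUnitaryGroup (Fin 2) ℂ)) :=
    wilsonMeasure (d := 3) (L := L) (fundamentalRep (Fin 2)) 0 with hμ₀
  haveI : IsProbabilityMeasure μ :=
    isProbabilityMeasure_wilsonMeasure (d := 3) (L := L) (fundamentalRep (Fin 2)) (continuous_fundamentalRep (Fin 2)) β'
  haveI : IsProbabilityMeasure μ₀ :=
    isProbabilityMeasure_wilsonMeasure (d := 3) (L := L) (fundamentalRep (Fin 2)) (continuous_fundamentalRep (Fin 2)) 0
  have hco : Continuous coords := continuous_coords (L := L)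
  /- 1. The weight `w = e^{−β'S}`, its two-sided ratio bound, and the density formula `μ = (∫ · w dμ₀)/(∫ w dμ₀)`. -/
  set B : ℝ := 4 * (Fintype.card (Plaquette 3 L) : ℝ) with hB
  set K : ℝ := Real.exp (|β'| * B) with hK
  have hKpos : 0 < K := Real.exp_pos _
  set w : GaugeConfig 3 L (Matrix.specialUnitaryGroup (Fin 2) ℂ) → ℝ :=
    fun U => Real.exp (-β' * wilsonAction (fundamentalRep (Fin 2)) U) with hw
  have hwpos : ∀ U, 0 < w U := fun U => Real.exp_pos _
  have hwc : Continuous w := Real.continuous_exp.comp (continuous_const.mul (continuous_wilsonAction_su2 (L := L)))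
  obtain ⟨U₀, -, hU₀⟩ := isCompact_univ.exists_isMinOn Set.univ_nonempty hwc.continuousOn
  have hw_ge : ∀ U, w U₀ ≤ w U := fun U => hU₀ (Set.mem_univ U)
  have hw_le : ∀ U, w U ≤ K * w U₀ := by
    intro U
    have hSU := wilsonAction_su2_nonneg (L := L) U
    have hSU' := wilsonAction_su2_le (L := L) U
    have hS0 := wilsonAction_su2_nonneg (L := L) U₀
    have hS0' := wilsonAction_su2_le (L := L) U₀
    have hdiff : β' * (wilsonAction (fundamentalRep (Fin 2)) U₀ - wilsonAction (fundamentalRep (Fin 2)) U) ≤ |β'| * B := by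
      calc β' * (wilsonAction (fundamentalRep (Fin 2)) U₀ - wilsonAction (fundamentalRep (Fin 2)) U)
          ≤ |β' * (wilsonAction (fundamentalRep (Fin 2)) U₀ - wilsonAction (fundamentalRep (Fin 2)) U)| := le_abs_self _
        _ = |β'| * |wilsonAction (fundamentalRep (Fin 2)) U₀ - wilsonAction (fundamentalRep (Fin 2)) U| := abs_mul _ _
        _ ≤ |β'| * B := mul_le_mul_of_nonneg_left (abs_sub_le_iff.2 ⟨by linarith, by linarith⟩) (abs_nonneg _)
    have e : w U = Real.exp (β' * (wilsonAction (fundamentalRep (Fin 2)) U₀ - wilsonAction (fundamentalRep (Fin 2)) U)) * w U₀ := by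
      simp only [hw, ← Real.exp_add]; congr 1; ring
    rw [e]
    exact mul_le_mul_of_nonneg_right (Real.exp_le_exp.2 hdiff) (hwpos U₀).le
  set z : ℝ := ∫ U, w U ∂μ₀ with hz
  have hwint : Integrable w μ₀ := integrable_of_continuous_of_compactSpace hwc μ₀
  have hzpos : 0 < z := by
    rw [hz]
    calc (0 : ℝ) < w U₀ := hwpos U₀
      _ = ∫ _U, w U₀ ∂μ₀ := by rw [integral_const, probReal_univ, one_smul]
      _ ≤ ∫ U, w U ∂μ₀ := integral_mono (integrable_const _) hwint hw_ge
  have hdens : ∀ h : GaugeConfig 3 L (Matrix.specialUnitaryGroup (Fin 2) ℂ) → ℝ,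
      ∫ U, h U ∂μ = (∫ U, h U * w U ∂μ₀) / z := by
    intro h
    have e := wilsonExpectation_eq_integral_div (d := 3) (L := L) (fundamentalRep (Fin 2))
      (continuous_fundamentalRep (Fin 2)) β' h
    rw [← wilsonMeasure_zero_eq_pi] at e
    exact e
  -- the two comparisons for continuous non-negative `h`
  have hcmp1 : ∀ h : GaugeConfig 3 L (Matrix.specialUnitaryGroup (Fin 2) ℂ) → ℝ, Continuous h → (∀ U, 0 ≤ h U) →
      z * ∫ U, h U ∂μ ≤ K * w U₀ * ∫ U, h U ∂μ₀ := by
    intro h hh h0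
    rw [hdens h, mul_div_cancel₀ _ hzpos.ne', ← integral_const_mul]
    exact integral_mono (integrable_of_continuous_of_compactSpace (hh.mul hwc) μ₀)
      ((integrable_of_continuous_of_compactSpace hh μ₀).const_mul _)
      fun U => by
        show h U * w U ≤ K * w U₀ * h U
        rw [mul_comm (K * w U₀)]
        exact mul_le_mul_of_nonneg_left (hw_le U) (h0 U)
  have hcmp2 : ∀ h : GaugeConfig 3 L (Matrix.specialUnitaryGroup (Fin 2) ℂ) → ℝ, Continuous h → (∀ U, 0 ≤ h U) →
      w U₀ * ∫ U, h U ∂μ₀ ≤ z * ∫ U, h U ∂μ := by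
    intro h hh h0
    rw [hdens h, mul_div_cancel₀ _ hzpos.ne', ← integral_const_mul]
    exact integral_mono ((integrable_of_continuous_of_compactSpace hh μ₀).const_mul _)
      (integrable_of_continuous_of_compactSpace (hh.mul hwc) μ₀)
      fun U => by
        show w U₀ * h U ≤ h U * w U
        rw [mul_comm (w U₀)]
        exact mul_le_mul_of_nonneg_left (hw_ge U) (h0 U)
  /- 2. Localisation: `F − m = g∘coords`, `g = χ·(f − m)` compactly supported, `𝓛g = 𝓛f` on the group. -/
  set m : ℝ := ∫ V', f (coords V') ∂μ with hm
  let χ : ContDiffBump (0 : (Edge 3 L × Fin 2 × Fin 2 × Bool) → ℝ) := ⟨2, 3, by norm_num, by norm_num⟩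
  set g : ((Edge 3 L × Fin 2 × Fin 2 × Bool) → ℝ) → ℝ := fun y =>
    (χ : ((Edge 3 L × Fin 2 × Fin 2 × Bool) → ℝ) → ℝ) y * (f y - m) with hgdef
  have hg : ContDiff ℝ 3 g := χ.contDiff.mul (hf.sub contDiff_const)
  have hgc : HasCompactSupport g := χ.hasCompactSupport.mul_right
  have hball : ∀ V : GaugeConfig 3 L (Matrix.specialUnitaryGroup (Fin 2) ℂ),
      coords V ∈ ball (0 : (Edge 3 L × Fin 2 × Fin 2 × Bool) → ℝ) 2 := by
    intro V
    rw [mem_ball, dist_zero_right]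
    exact (norm_coords_le_one V).trans_lt (by norm_num)
  have hEq : ∀ y ∈ ball (0 : (Edge 3 L × Fin 2 × Fin 2 × Bool) → ℝ) 2, g y = f y + (-m) := by
    intro y hy
    have h1 : (χ : ((Edge 3 L × Fin 2 × Fin 2 × Bool) → ℝ) → ℝ) y = 1 :=
      χ.one_of_mem_closedBall (ball_subset_closedBall hy)
    simp only [hgdef, h1, one_mul, sub_eq_add_neg]
  have hgF : ∀ V, g (coords V) = f (coords V) - m := fun V => by rw [hEq _ (hball V), ← sub_eq_add_neg]
  have hfd : ∀ V, fderiv ℝ g (coords V) = fderiv ℝ f (coords V) := fun V => fderiv_eq_of_eqOn_ball hEq (hball V)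
  have hfd2 : ∀ V (v : (Edge 3 L × Fin 2 × Fin 2 × Bool) → ℝ),
      fderiv ℝ (fun z => fderiv ℝ g z v) (coords V) = fderiv ℝ (fun z => fderiv ℝ f z v) (coords V) := fun V v =>
    fderiv_fderiv_eq_of_eqOn_ball hEq (hball V) v
  -- the centred observable and its means
  set G : GaugeConfig 3 L (Matrix.specialUnitaryGroup (Fin 2) ℂ) → ℝ := fun V => g (coords V) with hGdef
  have hGc : Continuous G := hg.continuous.comp hco
  have hG0 : ∫ V, G V ∂μ = 0 := by
    have hFi : Integrable (fun V => f (coords V)) μ := integrable_of_continuous_of_compactSpace (hf.continuous.comp hco) μ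
    simp_rw [hGdef, hgF]
    rw [integral_sub hFi (integrable_const m)]
    simp [hm]
  set m₀ : ℝ := ∫ V, G V ∂μ₀ with hm₀
  /- 3. The carré du champ of `g` (the same function at every coupling) and the noise/drift coefficients. -/
  set A : GaugeConfig 3 L (Matrix.specialUnitaryGroup (Fin 2) ℂ) → (Edge 3 L × Fin 2 × Fin 2 × Bool) →
      (Edge 3 L × Fin 2 × Fin 2 × Bool) → ℝ := fun V i j =>
    ∑ n : Edge 3 L × NoiseIdx 2,
      (if n.1 = i.1 then (fun z : ℂ => if i.2.2.2 then z.im else z.re)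
        ((latticeLangevinDynamics (fundamentalLatticeRep 2) β').noise
          (matrixConfig (fundamentalRep (Fin 2)) V) i.1 n.2 i.2.1 i.2.2.1) else 0) *
      (if n.1 = j.1 then (fun z : ℂ => if j.2.2.2 then z.im else z.re)
        ((latticeLangevinDynamics (fundamentalLatticeRep 2) β').noise
          (matrixConfig (fundamentalRep (Fin 2)) V) j.1 n.2 j.2.1 j.2.2.1) else 0) with hA
  set Γ : GaugeConfig 3 L (Matrix.specialUnitaryGroup (Fin 2) ℂ) → ℝ := fun V =>
    ∑ i : Edge 3 L × Fin 2 × Fin 2 × Bool, ∑ j : Edge 3 L × Fin 2 × Fin 2 × Bool,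
      fderiv ℝ g (coords V) (Pi.single i 1) * fderiv ℝ g (coords V) (Pi.single j 1) * A V i j with hΓ
  have hΓ0 : ∀ V, 0 ≤ Γ V := fun V => by
    simp only [hΓ, hA]
    exact carreDuChamp_nonneg (fun i => fderiv ℝ g (coords V) (Pi.single i 1))
      (fun i (n : Edge 3 L × NoiseIdx 2) => if n.1 = i.1 then (fun z : ℂ => if i.2.2.2 then z.im else z.re)
        ((latticeLangevinDynamics (fundamentalLatticeRep 2) β').noise
          (matrixConfig (fundamentalRep (Fin 2)) V) i.1 n.2 i.2.1 i.2.2.1) else 0)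
  have hΓc : Continuous Γ := by
    have hreim : ∀ (c : Bool) {q : GaugeConfig 3 L (Matrix.specialUnitaryGroup (Fin 2) ℂ) → ℂ}, Continuous q →
        Continuous fun V => (fun z : ℂ => if c then z.im else z.re) (q V) := by
      intro c q hq; cases c
      · exact Complex.continuous_re.comp hq
      · exact Complex.continuous_im.comp hq
    have hd1 : ∀ v, Continuous fun y : Edge 3 L × Fin 2 × Fin 2 × Bool → ℝ => fderiv ℝ g y v := fun v =>
      (hg.continuous_fderiv (by norm_num)).clm_apply continuous_const
    have hnoise : ∀ (i : Edge 3 L × Fin 2 × Fin 2 × Bool) (n : Edge 3 L × NoiseIdx 2), Continuous fun V : GaugeConfig 3 L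
        (Matrix.specialUnitaryGroup (Fin 2) ℂ) => (if n.1 = i.1 then (fun z : ℂ => if i.2.2.2 then z.im else z.re)
          ((latticeLangevinDynamics (fundamentalLatticeRep 2) β').noise (matrixConfig (fundamentalRep (Fin 2)) V)
            i.1 n.2 i.2.1 i.2.2.1) else 0) := by
      intro i n
      by_cases h : n.1 = i.1
      · simp only [if_pos h]
        exact hreim _ ((continuous_apply i.2.2.1).comp ((continuous_apply i.2.1).comp
          (continuous_noise_matrixConfig β' i.1 n.2)))
      · simp only [if_neg h]; exact continuous_const
    simp only [hΓ, hA]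
    refine continuous_finsetSum _ fun i _ => continuous_finsetSum _ fun j _ => ?_
    exact (((hd1 _).comp hco).mul ((hd1 _).comp hco)).mul (continuous_finsetSum _ fun n _ => (hnoise i n).mul (hnoise j n))
  /- 4. The energy identities at `β'` and at `0`, infinitesimal invariance at `0`, the Poincaré inequality at `0` for `g`. -/
  set geng : GaugeConfig 3 L (Matrix.specialUnitaryGroup (Fin 2) ℂ) → ℝ := fun V =>
    (∑ i : Edge 3 L × Fin 2 × Fin 2 × Bool, fderiv ℝ g (coords V) (Pi.single i 1) *
        (fun z : ℂ => if i.2.2.2 then z.im else z.re)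
          ((latticeLangevinDynamics (fundamentalLatticeRep 2) β').drift
            (matrixConfig (fundamentalRep (Fin 2)) V) i.1 i.2.1 i.2.2.1) +
    1 / 2 * ∑ i : Edge 3 L × Fin 2 × Fin 2 × Bool, ∑ j : Edge 3 L × Fin 2 × Fin 2 × Bool,
      fderiv ℝ (fun z => fderiv ℝ g z (Pi.single i 1)) (coords V) (Pi.single j 1) * A V i j) with hgengdef
  set geng0 : GaugeConfig 3 L (Matrix.specialUnitaryGroup (Fin 2) ℂ) → ℝ := fun V =>
    (∑ i : Edge 3 L × Fin 2 × Fin 2 × Bool, fderiv ℝ g (coords V) (Pi.single i 1) *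
        (fun z : ℂ => if i.2.2.2 then z.im else z.re)
          ((latticeLangevinDynamics (fundamentalLatticeRep 2) 0).drift
            (matrixConfig (fundamentalRep (Fin 2)) V) i.1 i.2.1 i.2.2.1) +
    1 / 2 * ∑ i : Edge 3 L × Fin 2 × Fin 2 × Bool, ∑ j : Edge 3 L × Fin 2 × Fin 2 × Bool,
      fderiv ℝ (fun z => fderiv ℝ g z (Pi.single i 1)) (coords V) (Pi.single j 1) * A V i j) with hgeng0def
  have hgen : ∀ V, geng V = gen V := by
    intro V
    simp only [hgengdef, gen, hA, hfd V, hfd2 V]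
  -- energy identity at `β'`: `2 ∫ G·𝓛g dμ = −∫ Γ dμ`
  have hcarre : 2 * ∫ V, G V * geng V ∂μ = -∫ V, Γ V ∂μ :=
    two_mul_integral_mul_generator_eq_neg_carre L β' hg hgc
  -- energy identity at `0` (same `Γ`: the noise coefficients do not depend on the coupling)
  have hcarre0 : 2 * ∫ V, G V * geng0 V ∂μ₀ = -∫ V, Γ V ∂μ₀ :=
    two_mul_integral_mul_generator_eq_neg_carre L 0 hg hgc
  -- infinitesimal invariance at `0`
  have hinv0 : ∫ V, geng0 V ∂μ₀ = 0 := integral_generator_wilson_eq_zero L 0 hg hgc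
  -- Poincaré at `0` for `g`
  have hP0g : lam0 * ∫ V, (G V - m₀) ^ 2 ∂μ₀ ≤ -∫ V, (G V - m₀) * geng0 V ∂μ₀ := hP0 g hg
  -- 5. The chain of inequalities.
  have hgeng0c : Continuous geng0 := continuous_generator (L := L) 0 (hg.of_le (by norm_num))
  have hgengc : Continuous geng := continuous_generator (L := L) β' (hg.of_le (by norm_num))
  -- (c) `λ₀ ∫ (G − m₀)² dμ₀ ≤ ½ ∫ Γ dμ₀`
  have hc : lam0 * ∫ V, (G V - m₀) ^ 2 ∂μ₀ ≤ (∫ V, Γ V ∂μ₀) / 2 := by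
    have e : ∫ V, (G V - m₀) * geng0 V ∂μ₀ = ∫ V, G V * geng0 V ∂μ₀ := by
      have e1 : ∀ V, (G V - m₀) * geng0 V = G V * geng0 V - m₀ * geng0 V := fun V => by ring
      simp_rw [e1]
      rw [integral_sub (integrable_of_continuous_of_compactSpace (f := fun V => G V * geng0 V) (hGc.mul hgeng0c) μ₀)
        ((integrable_of_continuous_of_compactSpace hgeng0c μ₀).const_mul m₀), integral_const_mul, hinv0, mul_zero, sub_zero]
    rw [e] at hP0g
    linarith
  have ha : ∫ V, (G V) ^ 2 ∂μ ≤ ∫ V, (G V - m₀) ^ 2 ∂μ := by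
    have h := variance_le_sq_integral_sub_const (L := L) β' hGc m₀
    rw [hG0] at h
    simpa using h
  have hb : z * ∫ V, (G V - m₀) ^ 2 ∂μ ≤ K * w U₀ * ∫ V, (G V - m₀) ^ 2 ∂μ₀ :=
    hcmp1 (fun V => (G V - m₀) ^ 2) ((hGc.sub continuous_const).pow 2) fun V => sq_nonneg _
  have hd : w U₀ * ∫ V, Γ V ∂μ₀ ≤ z * ∫ V, Γ V ∂μ := hcmp2 Γ hΓc hΓ0
  -- assemble: `z λ₀ Var ≤ K z (−∫ G 𝓛g dμ)`
  have hI0 : 0 ≤ ∫ V, (G V - m₀) ^ 2 ∂μ₀ := integral_nonneg fun V => sq_nonneg _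
  have hchain : z * (lam0 * ∫ V, (G V) ^ 2 ∂μ) ≤ z * (K * -∫ V, G V * geng V ∂μ) := by
    have h1 : z * (lam0 * ∫ V, (G V) ^ 2 ∂μ) ≤ lam0 * (K * w U₀ * ∫ V, (G V - m₀) ^ 2 ∂μ₀) := by
      calc z * (lam0 * ∫ V, (G V) ^ 2 ∂μ) = lam0 * (z * ∫ V, (G V) ^ 2 ∂μ) := by ring
        _ ≤ lam0 * (z * ∫ V, (G V - m₀) ^ 2 ∂μ) :=
            mul_le_mul_of_nonneg_left (mul_le_mul_of_nonneg_left ha hzpos.le) hlam0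
        _ ≤ lam0 * (K * w U₀ * ∫ V, (G V - m₀) ^ 2 ∂μ₀) := mul_le_mul_of_nonneg_left hb hlam0
    have h2 : lam0 * (K * w U₀ * ∫ V, (G V - m₀) ^ 2 ∂μ₀) ≤ K * w U₀ * ((∫ V, Γ V ∂μ₀) / 2) := by
      calc lam0 * (K * w U₀ * ∫ V, (G V - m₀) ^ 2 ∂μ₀) = K * w U₀ * (lam0 * ∫ V, (G V - m₀) ^ 2 ∂μ₀) := by ring
        _ ≤ K * w U₀ * ((∫ V, Γ V ∂μ₀) / 2) :=
            mul_le_mul_of_nonneg_left hc (mul_nonneg hKpos.le (hwpos U₀).le)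
    have h3 : K * w U₀ * ((∫ V, Γ V ∂μ₀) / 2) ≤ K * (z * ∫ V, Γ V ∂μ) / 2 := by
      calc K * w U₀ * ((∫ V, Γ V ∂μ₀) / 2) = K * (w U₀ * ∫ V, Γ V ∂μ₀) / 2 := by ring
        _ ≤ K * (z * ∫ V, Γ V ∂μ) / 2 := by
            have := mul_le_mul_of_nonneg_left hd hKpos.le
            linarith
    have h4 : K * (z * ∫ V, Γ V ∂μ) / 2 = z * (K * -∫ V, G V * geng V ∂μ) := by
      have : ∫ V, Γ V ∂μ = -2 * ∫ V, G V * geng V ∂μ := by linarith [hcarre]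
      rw [this]; ring
    linarith [h1, h2, h3, h4.le]
  have hmain : lam0 * ∫ V, (G V) ^ 2 ∂μ ≤ K * -∫ V, G V * geng V ∂μ := le_of_mul_le_mul_left hchain hzpos
  -- read back on `f`
  have hVar : ∫ V, (f (coords V) - m) ^ 2 ∂μ = ∫ V, (G V) ^ 2 ∂μ := by
    simp only [hGdef, hgF]
  have hDir : ∫ V, (f (coords V) - m) * gen V ∂μ = ∫ V, G V * geng V ∂μ := by
    simp only [hGdef, hgF, hgen]
  rw [hVar, hDir]
  have hKinv : Real.exp (-(|β'| * B)) * K = 1 := by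
    rw [hK, ← Real.exp_add, neg_add_cancel, Real.exp_zero]
  calc lam0 * Real.exp (-(|β'| * B)) * ∫ V, (G V) ^ 2 ∂μ
      = Real.exp (-(|β'| * B)) * (lam0 * ∫ V, (G V) ^ 2 ∂μ) := by ring
    _ ≤ Real.exp (-(|β'| * B)) * (K * -∫ V, G V * geng V ∂μ) :=
        mul_le_mul_of_nonneg_left hmain (Real.exp_pos _).le
    _ = -∫ V, G V * geng V ∂μ := by rw [← mul_assoc, hKinv, one_mul]

end Summit.QuantumFields.YangMills.Theorems.ColdStartUniversality

end
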